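import Literature.NumberTheory.EllipticCurves.H1TrivialAction
import HarnessLib

/-!
# The `n`-torsion comparison `α : H¹(G, M[n]) → H¹(G, M)[n]`: image and kernel
# (Greenberg–Vatsal 2000, proof of Prop. (2.8), WITHOUT the hypothesis `H⁰ = 0`) — part 1

HONEST FRAMING (cell `b2b-bsdres`, run/shared/lean/b2b/bsd-rank1-residual/, verbatim in every
file): the goal of the cell is to DELETE the COMBINATION-SHAPED residual classes of the
Birch–Swinnerton-Dyer formula for ALL analytic-rank `≤ 1` elliptic curves over `ℚ` — "full BSD
formula for every rank `≤ 1` curve in class `C`" assembled STRICTLY from published theorems — so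
that the rank-`≤ 1` remainder becomes exactly the CONSTRUCTION-SHAPED classes, which are TYPED
(missing-input `Prop`s), NOT attempted. This is not "finishing BSD". Sub-cell
`b2b-bsdres-eisenstein-p2` (CLASS-OWNERS row "X2"), gen 8: research route; NO CLAIM BEYOND STATED
CLASSES; nothing here changes a label. This file is GENERIC continuous group cohomology (no number
theory): every declaration is a definition with a body or a proved theorem; no named fact.

WHY (referee ruling R98.2, option (β)). Route G (Greenberg–Vatsal congruence transfer of `λ`, files
`X1/CongruenceTransfer.lean`, `X2/CongruenceTransfer*.lean`) rests, on the congruence classes with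
`φ = 1` (a rational `p`-torsion point on the `μ = 0` member, so `H⁰(ℚ, E₀[p]) ≠ 0`), on the
REMARK that Greenberg–Vatsal's Prop. (2.8) — printed under the hypothesis `H⁰(ℚ, A[π]) = 0`
(arXiv:math/9906215 p. 25: "Assume that `I_p` acts trivially on `D` and that `H⁰(ℚ, A[π]) = 0`.
Then `S^{Σ₀}_A(ℚ_∞)[π] ≅ S^{Σ₀}_{A[π]}(ℚ_∞)`") — survives without that hypothesis in the
corrected form `0 → A(ℚ_∞)/π → S^{Σ₀}_{A[π]}(ℚ_∞) → S^{Σ₀}_A(ℚ_∞)[π] → 0`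
(HOME/b2b-bsdres-eisenstein-p1/X1R0-GAPMAP.md §16.0; flag `GV-Prop28-H0-remark`: "clears on print
or on a kernel proof of the comparison"; the print branch is closed). THIS FILE AND
`X2/TorsionComparisonLocal.lean` ARE THE GROUP-COHOMOLOGICAL CORE OF THAT KERNEL PROOF, on the
tree's model of `H¹_cont` (`discreteH1` = Mathlib's `continuousCohomology 1`; explicit cocycles
`contOneCocycles` / `oneCocycleClass` of `GaloisRepresentations/ContinuousH1`; `resH1Hom`;
`cobCocycle`); the number-field instantiation is `X2/GreenbergVatsalTorsion.lean`.

CONTENT. `G` a topological group, `M` a discrete `G`-module, `n : ℕ`, `M[n]` its `n`-torsion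
(`AddSubgroup.torsionBy`, a `G`-submodule by `AddSubgroup.torsionBy.instDistribMulAction` of file
`GaloisAction`), `ι : M[n] ↪ M`, `α = ι_* : H¹(G, M[n]) → H¹(G, M)` (`torsionToH1`).
* §1 `nsmul_torsionToH1` (`n · α = 0`); **`range_torsionToH1_eq` : `im α = H¹(G, M)[n]`** for `M`
  `n`-DIVISIBLE with continuous orbit maps (a cocycle `f` with `n·[f] = 0` is corrected by the
  coboundary of an `n`-th root of the witness into an `M[n]`-valued cocycle).
* §2 `invariants G M = M^G`; `rootCocycle b` (`g ↦ g•b − b ∈ M[n]` for `n•b ∈ M^G`); the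
  CONNECTING HOMOMORPHISM **`delta : M^G →+ H¹(G, M[n])`** (`delta_apply_nsmul`);
  **`range_delta_eq_ker` : `im δ = ker α`**; **`mem_ker_delta_iff` : `ker δ = n·M^G`**; hence
  **`kerEquiv : M^G / n·M^G ≃+ ker α`** — the correction term (`#E(K_∞)[p]` for `M = E[p^∞]`).

References: Greenberg–Vatsal, Invent. Math. 142 (2000) = arXiv:math/9906215, §2 Prop. (2.8) and
its proof (p. 25); Serre, *Galois Cohomology*, I.§2.2–2.4, I.§5.1; Neukirch–Schmidt–Wingberg, (1.2).
-/

noncomputable section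

open scoped Classical AddSubgroup

universe u

namespace Summit.BirchSwinnertonDyer.Rank1Residual.X2.TorsionComparison

open Literature.NumberTheory.EllipticCurves Literature.NumberTheory.GaloisRepresentations

variable {G : Type u} [Group G] [TopologicalSpace G] [IsTopologicalGroup G]
variable {M : Type u} [AddCommGroup M] [DistribMulAction G M] [TopologicalSpace M]
  [DiscreteTopology M]

/-! ## §1. `α : H¹(G, M[n]) → H¹(G, M)` and its image -/

section Alpha

variable (M) in
/-- The inclusion `ι : M[n] ↪ M` of the `n`-torsion subgroup (Mathlib's `AddSubgroup.subtype`).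
[folklore] -/
abbrev torsionIncl (n : ℕ) : M[(n : ℤ)] →+ M :=
  (M[(n : ℤ)]).subtype

omit [IsTopologicalGroup G] [TopologicalSpace M] [DiscreteTopology M] in
/-- `ι` is `G`-equivariant (the action on `M[n]` is the restricted one). [folklore] -/
theorem torsionIncl_smul (n : ℕ) (g : G) (x : M[(n : ℤ)]) :
    torsionIncl M n (ContinuousMonoidHom.id G g • x) = g • torsionIncl M n x :=
  rfl

omit [TopologicalSpace M] [DiscreteTopology M] in
/-- `ι` is injective. [folklore] -/
theorem torsionIncl_injective (n : ℕ) : Function.Injective (torsionIncl M n) :=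
  Subtype.val_injective

variable (G M) in
/-- **`α = ι_* : H¹(G, M[n]) → H¹(G, M)`**, the map induced by the inclusion of the `n`-torsion
(the compatible pair `(id_G, ι)`; Mathlib's `ContinuousCohomology.map` through `resH1Hom`).
Greenberg–Vatsal 2000, proof of Prop. (2.8): "The natural map
`H¹(ℚ_Σ/ℚ_∞, A[π]) → H¹(ℚ_Σ/ℚ_∞, A)[π]` induced from the exact sequence
`0 → A[π] → A → A → 0`". [cite: GreenbergVatsal2000, §2 Prop. (2.8) (proof, p. 25)] -/
def torsionToH1 (n : ℕ) : discreteH1 G (M[(n : ℤ)]) →+ discreteH1 G M :=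
  resH1Hom (ContinuousMonoidHom.id G) (torsionIncl M n) (torsionIncl_smul n)

/-- `α [f] = [ι ∘ f]` on explicit cocycles. [folklore] -/
theorem torsionToH1_oneCocycleClass (n : ℕ)
    (f : contOneCocycles (discreteTopRep G (M[(n : ℤ)]))) :
    torsionToH1 G M n (oneCocycleClass _ f) =
      oneCocycleClass _ (contOneCocycles.push (torsionIncl M n) (torsionIncl_smul n) f) :=
  resH1Hom_id_oneCocycleClass _ _ f

/-- **`n · α = 0`**: the image of `α` consists of `n`-torsion classes (an `M[n]`-valued cocycle is
killed by `n` pointwise). [cite: GreenbergVatsal2000, §2 Prop. (2.8) (proof, p. 25)] -/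
theorem nsmul_torsionToH1 (n : ℕ) (c : discreteH1 G (M[(n : ℤ)])) :
    n • torsionToH1 G M n c = 0 := by
  obtain ⟨f, rfl⟩ := classHom_surjective (G := G) (M := M[(n : ℤ)]) c
  rw [classHom_apply, torsionToH1_oneCocycleClass]
  refine nsmul_oneCocycleClass_eq_zero _ n fun g ↦ ?_
  rw [contOneCocycles.push_apply]
  change n • ((f.1 g : M[(n : ℤ)]) : M) = 0
  rw [← AddSubgroupClass.coe_nsmul, AddSubgroup.torsionBy.nsmul, ZeroMemClass.coe_zero]

/-- The image of `α` lies in `H¹(G, M)[n]`.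
[cite: GreenbergVatsal2000, §2 Prop. (2.8) (proof, p. 25)] -/
theorem torsionToH1_mem_torsionBy (n : ℕ) (c : discreteH1 G (M[(n : ℤ)])) :
    torsionToH1 G M n c ∈ (discreteH1 G M)[(n : ℤ)] :=
  AddSubgroup.torsionBy.nsmul_iff.mpr (nsmul_torsionToH1 n c)

/-- **`im α = H¹(G, M)[n]` for `n`-divisible `M`.** If every orbit map `g ↦ g • m` is continuous
and `M` is `n`-divisible, a class `c` with `n • c = 0` comes from `H¹(G, M[n])`: writing `c = [f]`,
`n • f` is the coboundary of some `v`, `v = n • w`, and `f − ∂w` takes values in `M[n]`. This is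
the surjectivity half of the exact sequence `H¹(G, M[n]) → H¹(G, M) →ⁿ H¹(G, M)` of
`0 → M[n] → M →ⁿ M → 0`. [cite: GreenbergVatsal2000, §2 Prop. (2.8) (proof, p. 25)] -/
theorem mem_range_torsionToH1_iff (hM : ∀ m : M, Continuous fun g : G ↦ g • m) {n : ℕ}
    (hdiv : ∀ m : M, ∃ m' : M, n • m' = m) (c : discreteH1 G M) :
    c ∈ (torsionToH1 G M n).range ↔ n • c = 0 := by
  constructor
  · rintro ⟨c', rfl⟩
    exact nsmul_torsionToH1 n c'
  · intro hc
    obtain ⟨f, rfl⟩ := classHom_surjective (G := G) (M := M) c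
    rw [← map_nsmul (classHom G M), classHom_apply, oneCocycleClass_eq_zero_iff] at hc
    obtain ⟨v, hv⟩ := hc
    obtain ⟨w, rfl⟩ := hdiv v
    -- `f₁ = f - ∂w` takes values in `M[n]`
    have hval : ∀ g, n • (f - cobCocycle w (hM w)).1 g = 0 := fun g ↦ by
      have h1 : n • f.1 g = g • (n • w) - n • w := by
        have := hv g
        rwa [nsmul_apply_val] at this
      rw [sub_apply_val, cobCocycle_apply, smul_sub, h1, smul_sub, smul_comm n g w, sub_self]
    let f₀ : contOneCocycles (discreteTopRep G (M[(n : ℤ)])) :=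
      contOneCocycles.lift (torsionIncl M n) (torsionIncl_smul n) (torsionIncl_injective n)
        (f - cobCocycle w (hM w)) (fun g ↦ ⟨(f - cobCocycle w (hM w)).1 g,
          AddSubgroup.torsionBy.nsmul_iff.mpr (hval g)⟩) (fun _ ↦ rfl)
    refine ⟨oneCocycleClass _ f₀, ?_⟩
    rw [torsionToH1_oneCocycleClass, contOneCocycles.push_lift, oneCocycleClass_sub,
      oneCocycleClass_cobCocycle, sub_zero, classHom_apply]

/-- `im α = H¹(G, M)[n]` as subgroups, for `n`-divisible `M`.
[cite: GreenbergVatsal2000, §2 Prop. (2.8) (proof, p. 25)] -/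
theorem range_torsionToH1_eq (hM : ∀ m : M, Continuous fun g : G ↦ g • m) {n : ℕ}
    (hdiv : ∀ m : M, ∃ m' : M, n • m' = m) :
    (torsionToH1 G M n).range = (discreteH1 G M)[(n : ℤ)] := by
  ext c
  rw [mem_range_torsionToH1_iff hM hdiv, AddSubgroup.torsionBy.nsmul_iff]

end Alpha

/-! ## §2. The connecting homomorphism `δ : M^G → H¹(G, M[n])` and `ker α = im δ ≅ M^G/n` -/

section Delta

variable (G M) in
/-- The invariants `M^G = H⁰(G, M)` as an additive subgroup. Serre, *Galois Cohomology*, I.§2.1.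
[folklore] -/
def invariants : AddSubgroup M where
  carrier := {m | ∀ g : G, g • m = m}
  zero_mem' g := smul_zero g
  add_mem' {a b} ha hb g := by rw [smul_add, ha g, hb g]
  neg_mem' {a} ha g := by rw [smul_neg, ha g]

omit [TopologicalSpace G] [IsTopologicalGroup G] [TopologicalSpace M] [DiscreteTopology M] in
/-- Membership in `M^G`. [folklore] -/
theorem mem_invariants_iff (m : M) : m ∈ invariants G M ↔ ∀ g : G, g • m = m :=
  Iff.rfl

/-- **The `M[n]`-valued cocycle `g ↦ g • b − b` of an `n`-th root `b` of an invariant**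
(`n • b ∈ M^G` forces `n • (g•b − b) = 0`): the coboundary of `b`, lifted to `M[n]`. Serre, *Galois
Cohomology*, I.§5.1 (connecting map of `0 → A' → A → A'' → 0`). [folklore] -/
def rootCocycle (hM : ∀ m : M, Continuous fun g : G ↦ g • m) (n : ℕ) (b : M)
    (hb : n • b ∈ invariants G M) : contOneCocycles (discreteTopRep G (M[(n : ℤ)])) :=
  contOneCocycles.lift (torsionIncl M n) (torsionIncl_smul n) (torsionIncl_injective n)
    (cobCocycle b (hM b)) (fun g ↦ ⟨g • b - b, AddSubgroup.torsionBy.nsmul_iff.mpr (by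
      rw [smul_sub, smul_comm n g b, (mem_invariants_iff _).1 hb g, sub_self])⟩) (fun _ ↦ rfl)

omit [IsTopologicalGroup G] in
/-- Values of `rootCocycle`: `(g ↦ g • b − b)`. [folklore] -/
@[simp]
theorem coe_rootCocycle_apply (hM : ∀ m : M, Continuous fun g : G ↦ g • m) (n : ℕ) (b : M)
    (hb : n • b ∈ invariants G M) (g : G) :
    (((rootCocycle hM n b hb).1 g : M[(n : ℤ)]) : M) = g • b - b :=
  rfl

omit [IsTopologicalGroup G] in
/-- `ι ∘ rootCocycle b = ∂b`. [folklore] -/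
theorem push_rootCocycle (hM : ∀ m : M, Continuous fun g : G ↦ g • m) (n : ℕ) (b : M)
    (hb : n • b ∈ invariants G M) :
    contOneCocycles.push (torsionIncl M n) (torsionIncl_smul n) (rootCocycle hM n b hb) =
      cobCocycle b (hM b) :=
  contOneCocycles.push_lift _ _ _ _ _ _

/-- `α [rootCocycle b] = 0` (its image in `H¹(G, M)` is the class of a coboundary). [folklore] -/
theorem torsionToH1_rootClass (hM : ∀ m : M, Continuous fun g : G ↦ g • m) (n : ℕ) (b : M)
    (hb : n • b ∈ invariants G M) :
    torsionToH1 G M n (oneCocycleClass _ (rootCocycle hM n b hb)) = 0 := by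
  rw [torsionToH1_oneCocycleClass, push_rootCocycle, oneCocycleClass_cobCocycle]

omit [IsTopologicalGroup G] in
/-- `rootCocycle` is additive in the root: `rootCocycle (b + b') = rootCocycle b + rootCocycle b'`.
[folklore] -/
theorem rootCocycle_add (hM : ∀ m : M, Continuous fun g : G ↦ g • m) (n : ℕ) (b b' : M)
    (hb : n • b ∈ invariants G M) (hb' : n • b' ∈ invariants G M)
    (hbb' : n • (b + b') ∈ invariants G M) :
    rootCocycle hM n (b + b') hbb' = rootCocycle hM n b hb + rootCocycle hM n b' hb' := by
  apply Subtype.ext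
  ext g
  change g • (b + b') - (b + b') = (g • b - b) + (g • b' - b')
  rw [smul_add]
  abel

omit [IsTopologicalGroup G] in
/-- Continuity of the orbit maps of `M[n]` (from those of `M`). [folklore] -/
theorem continuous_smul_torsionBy (hM : ∀ m : M, Continuous fun g : G ↦ g • m) (n : ℕ)
    (t : M[(n : ℤ)]) : Continuous fun g : G ↦ g • t :=
  continuous_of_injective_comp (torsionIncl_injective n) (by
    change Continuous fun g : G ↦ g • (t : M)
    exact hM t)

/-- The root cocycle of an element `t ∈ M[n]` (so `n • t = 0 ∈ M^G`) is the coboundary of `t` IN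
`M[n]`, hence has trivial class. [folklore] -/
theorem rootClass_eq_zero_of_nsmul_eq_zero (hM : ∀ m : M, Continuous fun g : G ↦ g • m) (n : ℕ)
    (t : M) (ht : n • t = 0) (ht' : n • t ∈ invariants G M) :
    oneCocycleClass _ (rootCocycle hM n t ht') = 0 := by
  have e : rootCocycle hM n t ht' =
      cobCocycle (⟨t, AddSubgroup.torsionBy.nsmul_iff.mpr ht⟩ : M[(n : ℤ)])
        (continuous_smul_torsionBy hM n _) := by
    apply Subtype.ext; ext g; rfl
  rw [e, oneCocycleClass_cobCocycle]

/-- **Independence of the root**: if `n • b = n • b'` (both invariant) then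
`[rootCocycle b] = [rootCocycle b']` (the difference is the coboundary of `b − b' ∈ M[n]`).
[folklore] -/
theorem rootClass_eq_of_nsmul_eq (hM : ∀ m : M, Continuous fun g : G ↦ g • m) (n : ℕ) (b b' : M)
    (hb : n • b ∈ invariants G M) (hb' : n • b' ∈ invariants G M) (h : n • b = n • b') :
    oneCocycleClass _ (rootCocycle hM n b hb) = oneCocycleClass _ (rootCocycle hM n b' hb') := by
  have hneg : n • (-b') ∈ invariants G M := by rw [smul_neg]; exact neg_mem hb'
  have hdiff0 : n • (b + -b') = 0 := by rw [smul_add, smul_neg, h, add_neg_cancel]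
  have hdiff : n • (b + -b') ∈ invariants G M := by rw [hdiff0]; exact zero_mem _
  have e1 : rootCocycle hM n b hb = rootCocycle hM n (b + -b') hdiff + rootCocycle hM n b' hb' := by
    apply Subtype.ext; ext g
    change g • b - b = (g • (b + -b') - (b + -b')) + (g • b' - b')
    rw [smul_add, smul_neg]
    abel
  rw [e1, oneCocycleClass_add, rootClass_eq_zero_of_nsmul_eq_zero hM n _ hdiff0, zero_add]

/-- A chosen `n`-th root in an `n`-divisible group. [folklore] -/
def root {n : ℕ} (hdiv : ∀ m : M, ∃ m' : M, n • m' = m) (m : M) : M :=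
  Classical.choose (hdiv m)

omit [TopologicalSpace G] [IsTopologicalGroup G] [TopologicalSpace M] [DiscreteTopology M]
  [DistribMulAction G M] in
/-- `n • root m = m`. [folklore] -/
@[simp]
theorem nsmul_root {n : ℕ} (hdiv : ∀ m : M, ∃ m' : M, n • m' = m) (m : M) :
    n • root hdiv m = m :=
  Classical.choose_spec (hdiv m)

omit [TopologicalSpace G] [IsTopologicalGroup G] [TopologicalSpace M] [DiscreteTopology M] in
/-- `n • root a ∈ M^G` for `a ∈ M^G`. [folklore] -/
theorem nsmul_root_mem {n : ℕ} (hdiv : ∀ m : M, ∃ m' : M, n • m' = m) (a : invariants G M) :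
    n • root hdiv (a : M) ∈ invariants G M := by
  rw [nsmul_root]; exact a.2

variable (G M) in
/-- **The connecting homomorphism `δ : M^G → H¹(G, M[n])`** of `0 → M[n] → M →ⁿ M → 0` for an
`n`-divisible discrete `G`-module `M`: `δ(a) = [g ↦ g • b − b]` for any `b` with `n • b = a`
(well defined by `rootClass_eq_of_nsmul_eq`). Serre, *Galois Cohomology*, I.§5.1; Greenberg–Vatsal
2000, proof of Prop. (2.8) (the case `H⁰(ℚ_∞, A) = 0`, where `δ = 0`).
[cite: GreenbergVatsal2000, §2 Prop. (2.8) (proof, p. 25)] -/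
def delta (hM : ∀ m : M, Continuous fun g : G ↦ g • m) {n : ℕ}
    (hdiv : ∀ m : M, ∃ m' : M, n • m' = m) : invariants G M →+ discreteH1 G (M[(n : ℤ)]) where
  toFun a := oneCocycleClass _ (rootCocycle hM n (root hdiv (a : M)) (nsmul_root_mem hdiv a))
  map_zero' := by
    have h0 : n • (0 : M) ∈ invariants G M := by rw [smul_zero]; exact zero_mem _
    rw [rootClass_eq_of_nsmul_eq hM n _ 0 (nsmul_root_mem hdiv 0) h0
      (by rw [nsmul_root, smul_zero]; rfl)]
    exact rootClass_eq_zero_of_nsmul_eq_zero hM n 0 (smul_zero _) h0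
  map_add' a a' := by
    have hsum : n • (root hdiv (a : M) + root hdiv (a' : M)) ∈ invariants G M := by
      rw [smul_add, nsmul_root, nsmul_root]; exact add_mem a.2 a'.2
    rw [rootClass_eq_of_nsmul_eq hM n _ _ (nsmul_root_mem hdiv (a + a')) hsum
      (by rw [nsmul_root, smul_add, nsmul_root, nsmul_root]; rfl),
      rootCocycle_add hM n _ _ (nsmul_root_mem hdiv a) (nsmul_root_mem hdiv a'),
      oneCocycleClass_add]

/-- **`δ(n • b) = [g ↦ g • b − b]`** for ANY root `b` (not just the chosen one).
[cite: GreenbergVatsal2000, §2 Prop. (2.8) (proof, p. 25)] -/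
theorem delta_apply_nsmul (hM : ∀ m : M, Continuous fun g : G ↦ g • m) {n : ℕ}
    (hdiv : ∀ m : M, ∃ m' : M, n • m' = m) (b : M) (hb : n • b ∈ invariants G M) :
    delta G M hM hdiv ⟨n • b, hb⟩ = oneCocycleClass _ (rootCocycle hM n b hb) :=
  rootClass_eq_of_nsmul_eq hM n _ b (nsmul_root_mem hdiv _) hb (by rw [nsmul_root])

/-- `α ∘ δ = 0`. [cite: GreenbergVatsal2000, §2 Prop. (2.8) (proof, p. 25)] -/
theorem torsionToH1_delta (hM : ∀ m : M, Continuous fun g : G ↦ g • m) {n : ℕ}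
    (hdiv : ∀ m : M, ∃ m' : M, n • m' = m) (a : invariants G M) :
    torsionToH1 G M n (delta G M hM hdiv a) = 0 :=
  torsionToH1_rootClass hM n _ _

/-- **Exactness at `H¹(G, M[n])`: `ker α = im δ`.** A class `[f]` with `[ι ∘ f] = 0` has
`ι ∘ f = ∂v` for some `v ∈ M`; then `n • v ∈ M^G` and `f = rootCocycle v`, so `[f] = δ(n • v)`.
Serre, *Galois Cohomology*, I.§5.1 (exact hexagon in low degree); Greenberg–Vatsal 2000, proof of
Prop. (2.8). [cite: GreenbergVatsal2000, §2 Prop. (2.8) (proof, p. 25)] -/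
theorem range_delta_eq_ker (hM : ∀ m : M, Continuous fun g : G ↦ g • m) {n : ℕ}
    (hdiv : ∀ m : M, ∃ m' : M, n • m' = m) :
    (delta G M hM hdiv).range = (torsionToH1 G M n).ker := by
  ext c
  constructor
  · rintro ⟨a, rfl⟩
    exact (AddMonoidHom.mem_ker).2 (torsionToH1_delta hM hdiv a)
  · intro hc
    obtain ⟨f, rfl⟩ := classHom_surjective (G := G) (M := M[(n : ℤ)]) c
    rw [AddMonoidHom.mem_ker, classHom_apply, torsionToH1_oneCocycleClass,
      oneCocycleClass_eq_zero_iff] at hc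
    obtain ⟨v, hv⟩ := hc
    have hvn : n • v ∈ invariants G M := by
      rw [mem_invariants_iff]
      intro g
      rw [← sub_eq_zero, ← smul_comm n g v, ← smul_sub]
      have h1 : ((f.1 g : M[(n : ℤ)]) : M) = g • v - v := hv g
      rw [← h1, ← AddSubgroupClass.coe_nsmul, AddSubgroup.torsionBy.nsmul, ZeroMemClass.coe_zero]
    refine ⟨⟨n • v, hvn⟩, ?_⟩
    rw [delta_apply_nsmul hM hdiv v hvn, classHom_apply]
    congr 1
    apply Subtype.ext; ext g
    exact (hv g).symm

/-- **`ker δ = n · M^G`**: `δ(a) = 0` iff `a = n • m` for some INVARIANT `m`. (If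
`[rootCocycle b] = 0`, `g • b − b = g • t − t` for some `t ∈ M[n]`, so `m = b − t ∈ M^G` and
`n • m = n • b = a`.) Serre, *Galois Cohomology*, I.§5.1 (exactness at `H⁰(G, A'')`).
[cite: GreenbergVatsal2000, §2 Prop. (2.8) (proof, p. 25)] -/
theorem mem_ker_delta_iff (hM : ∀ m : M, Continuous fun g : G ↦ g • m) {n : ℕ}
    (hdiv : ∀ m : M, ∃ m' : M, n • m' = m) (a : invariants G M) :
    a ∈ (delta G M hM hdiv).ker ↔ ∃ m ∈ invariants G M, n • m = (a : M) := by
  rw [AddMonoidHom.mem_ker]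
  constructor
  · intro h
    set b := root hdiv (a : M) with hbdef
    have hb : n • b = (a : M) := nsmul_root hdiv _
    change oneCocycleClass _ (rootCocycle hM n b (nsmul_root_mem hdiv a)) = 0 at h
    rw [oneCocycleClass_eq_zero_iff] at h
    obtain ⟨t, ht⟩ := h
    refine ⟨b - (t : M), (mem_invariants_iff _).2 fun g ↦ ?_, ?_⟩
    · have h1 := congrArg (fun x : M[(n : ℤ)] ↦ (x : M)) (ht g)
      change g • b - b = ((g • t - t : M[(n : ℤ)]) : M) at h1
      rw [AddSubgroupClass.coe_sub, AddSubgroup.torsionBy.coe_smul] at h1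
      rw [smul_sub, sub_eq_sub_iff_sub_eq_sub, h1]
    · rw [smul_sub, hb, ← AddSubgroupClass.coe_nsmul, AddSubgroup.torsionBy.nsmul,
        ZeroMemClass.coe_zero, sub_zero]
  · rintro ⟨m, hm, hma⟩
    have hmn : n • m ∈ invariants G M := by rw [hma]; exact a.2
    have ea : a = ⟨n • m, hmn⟩ := Subtype.ext hma.symm
    rw [ea, delta_apply_nsmul hM hdiv m hmn, oneCocycleClass_eq_zero_iff]
    refine ⟨0, fun g ↦ Subtype.ext ?_⟩
    change g • m - m = ((g • (0 : M[(n : ℤ)]) - 0 : M[(n : ℤ)]) : M)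
    rw [smul_zero, sub_zero, ZeroMemClass.coe_zero, (mem_invariants_iff m).1 hm g, sub_self]

variable (G M) in
/-- `n · M^G` as a subgroup of `M^G` (the image of multiplication by `n`). [folklore] -/
def nsmulInvariants (n : ℕ) : AddSubgroup (invariants G M) :=
  (nsmulAddMonoidHom (α := invariants G M) n).range

omit [TopologicalSpace G] [IsTopologicalGroup G] [TopologicalSpace M] [DiscreteTopology M] in
/-- Membership in `n · M^G`. [folklore] -/
theorem mem_nsmulInvariants_iff (n : ℕ) (a : invariants G M) :
    a ∈ nsmulInvariants G M n ↔ ∃ m ∈ invariants G M, n • m = (a : M) := by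
  constructor
  · rintro ⟨m, rfl⟩
    exact ⟨m, m.2, rfl⟩
  · rintro ⟨m, hm, hma⟩
    exact ⟨⟨m, hm⟩, Subtype.ext hma⟩

/-- `ker δ = n · M^G` as subgroups. [cite: GreenbergVatsal2000, §2 Prop. (2.8) (proof, p. 25)] -/
theorem ker_delta_eq (hM : ∀ m : M, Continuous fun g : G ↦ g • m) {n : ℕ}
    (hdiv : ∀ m : M, ∃ m' : M, n • m' = m) :
    (delta G M hM hdiv).ker = nsmulInvariants G M n := by
  ext a
  rw [mem_ker_delta_iff, mem_nsmulInvariants_iff]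

/-- **`ker α ≅ M^G / n·M^G`** (first isomorphism theorem for `δ`, with `im δ = ker α`).
Greenberg–Vatsal 2000, proof of Prop. (2.8) — there `M^G = H⁰(ℚ_∞, A) = 0`, here in general.
[cite: GreenbergVatsal2000, §2 Prop. (2.8) (proof, p. 25)] -/
def kerEquiv (hM : ∀ m : M, Continuous fun g : G ↦ g • m) {n : ℕ}
    (hdiv : ∀ m : M, ∃ m' : M, n • m' = m) :
    invariants G M ⧸ nsmulInvariants G M n ≃+ (torsionToH1 G M n).ker :=
  ((QuotientAddGroup.quotientAddEquivOfEq (ker_delta_eq hM hdiv)).symm.trans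
    (QuotientAddGroup.quotientKerEquivRange (delta G M hM hdiv))).trans
    (AddEquiv.addSubgroupCongr (range_delta_eq_ker hM hdiv))

end Delta

end Summit.BirchSwinnertonDyer.Rank1Residual.X2.TorsionComparison

end
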